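import Literature.Barriers.SmoothPoincare4.ExoticOpenFourSpace
import Mathlib.Analysis.InnerProductSpace.Calculus
import Mathlib.Geometry.Manifold.ContMDiff.NormedSpace
import Mathlib.Geometry.Manifold.ContMDiff.Atlas
import HarnessLib

/-!
# Barrier (SmoothPoincare4): exotic open `ℝ⁴`-homeomorphs sit inside EVERY smooth 4-manifold — transport companion

Companion of `Literature/Barriers/SmoothPoincare4/ExoticOpenFourSpace.lean` (theorems and smooth
plumbing only; no new named fact), next to the sibling proofs file
`ExoticOpenFourSpaceProofs.lean` (DeMichelis–Freedman Cor. 4.1 from Thm. 4.1, the ZFC step).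

## Triage of the provefact item for `OpenSubsetUniquenessFour` (verdict: not a fact)

The barrier file renders the technique class "an open subset of `ℝ⁴` homeomorphic to `ℝ⁴` is
diffeomorphic to `ℝ⁴`" as the `Prop` `Literature.Barriers.SmoothPoincare4.OpenSubsetUniquenessFour`
and proves there that it is EQUIVALENT to the negation of the tree's named fact spc4.S11
(`openSubsetUniquenessFour_iff_not_exoticR4`; spc4.S11 =
`Literature.Topology.FourManifolds.exists_opens_nonempty_homeomorph_isEmpty_diffeomorph_euclideanSpace_four`,
Mathlib's `proof_wanted exists_open_nonempty_homeomorph_isEmpty_diffeomorph_euclideanSpace_four`).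
What the cited source prints is that negation — R. Kirby, *The Topology of 4-Manifolds* (LNM 1374,
1989), Ch. XIV, p. 95: "there would be open sets which were homeomorphic to `R⁴` but weren't
smoothly `R⁴`", and Theorem 3 (Casson and Freedman), p. 98: "There exists an exotic `R⁴_Θ` which
imbeds smoothly in `S⁴`" (proof pp. 98–101, from Donaldson's compact counterexample `Y⁵` to the
smooth h-cobordism theorem between `CP² # 9(-CP²)` and the Dolgachev surface). Hence
`OpenSubsetUniquenessFour` admits no discharge `OpenSubsetUniquenessFour_holds`; its corrected
(negated) form is already vendored as `OpenAnalogueBarrierFour` and proved relative to spc4.S11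
(`openAnalogueBarrierFour_of_exoticR4`), and an unconditional proof of the barrier is exactly a
formal construction of a small exotic `ℝ⁴` (size XL).

## What is proved here

The barrier file shows that the standard `S⁴` contains an open subset homeomorphic but not
diffeomorphic to `ℝ⁴` (`exists_opens_sphere_homeomorph_not_diffeomorph`, stereographic pull-back).
Here the same is proved for EVERY nonempty smooth 4-manifold `M` modelled on `ℝ⁴`
(`exists_opens_homeomorph_not_diffeomorph_of_exoticR4`): push the small exotic `ℝ⁴` of spc4.S11
into a round ball of a chart target along Mathlib's smooth diffeomorphism
`OpenPartialHomeomorph.univBall c r : ℝ⁴ ≅ ball c r` and pull it back along the chart (an exotic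
`ℝ⁴` which "imbeds smoothly in `S⁴`" as in Theorem 3 is an open subset of standard `ℝ⁴`, and
standard `ℝ⁴` is diffeomorphic to every round ball of every chart). Consequently (relative to
spc4.S11) the master statement fails inside every smooth 4-manifold
(`not_forall_opens_diffeomorph_of_exoticR4`), in particular inside every homotopy 4-sphere `Σ`,
standard or not: the presence in `Σ` of an open `ℝ⁴`-homeomorph that is not diffeomorphic to `ℝ⁴`
carries no information about `Σ`. With DeMichelis–Freedman's continuum family
(`deMichelisFreedman1992_continuum`) the same transport gives continuum many pairwise
non-diffeomorphic such subsets of every `M` (`exists_continuum_opens_of_deMichelisFreedman`).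

Smooth plumbing, stated for a general model with corners `I`:
* `pullbackOpens e B` — the open set `e.source ∩ e ⁻¹' B` of an open partial homeomorphism;
* `opensDiffeomorphOfSubsetTarget` — an open partial homeomorphism which is `C^∞` on its source
  with `C^∞` inverse on its target restricts to a diffeomorphism `e ⁻¹' B ≅ B` for every open
  `B ⊆ e.target` (both sides as open submanifolds);
* `chartPullbackDiffeomorph` — the case of a chart of a `C^∞` manifold;
* `ballPushforwardDiffeomorph` — the case of `(univBall c r).symm` in an inner product space:
  `univBall c r '' U ≅ U` for every open `U`.

## References

* R. C. Kirby, *The Topology of 4-Manifolds*, Lecture Notes in Math. 1374, Springer 1989,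
  Ch. XIV (pp. 95–101), Theorems 1–3 [Kirby1989].
* S. DeMichelis, M. H. Freedman, *Uncountably many exotic `R⁴`'s in standard 4-space*,
  J. Differential Geom. 35 (1992) 219–254, Thm. 4.1, Cor. 4.1 [DeMichelisFreedman1992].
-/

noncomputable section

open scoped Manifold ContDiff
open TopologicalSpace Set

namespace Literature.Barriers.SmoothPoincare4

/-- Local notation: `𝔼 n` is the model Euclidean space `EuclideanSpace ℝ (Fin n)`. -/
local notation "𝔼 " n:arg => EuclideanSpace ℝ (Fin n)

/-! ### Smooth plumbing: restricting open partial homeomorphisms to open submanifolds -/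

section Plumbing

variable {𝕜 : Type*} [NontriviallyNormedField 𝕜]
  {E : Type*} [NormedAddCommGroup E] [NormedSpace 𝕜 E] {H : Type*} [TopologicalSpace H]
  (I : ModelWithCorners 𝕜 E H) {M : Type*} [TopologicalSpace M] [ChartedSpace H M]
  {E' : Type*} [NormedAddCommGroup E'] [NormedSpace 𝕜 E'] {H' : Type*} [TopologicalSpace H']
  (I' : ModelWithCorners 𝕜 E' H') {N : Type*} [TopologicalSpace N] [ChartedSpace H' N]

/-- The pull-back `e.source ∩ e ⁻¹' B` of an open set `B ⊆ N` along an open partial homeomorphism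
`e`, as an open subset of `M`. [folklore] -/
def pullbackOpens (e : OpenPartialHomeomorph M N) (B : Opens N) : Opens M :=
  ⟨e.source ∩ e ⁻¹' (B : Set N), e.isOpen_inter_preimage B.isOpen⟩

/-- Unfolding `pullbackOpens`. [folklore] -/
@[simp]
theorem coe_pullbackOpens (e : OpenPartialHomeomorph M N) (B : Opens N) :
    (pullbackOpens e B : Set M) = e.source ∩ e ⁻¹' (B : Set N) :=
  rfl

/-- Membership in `pullbackOpens`. [folklore] -/
theorem mem_pullbackOpens {e : OpenPartialHomeomorph M N} {B : Opens N} {x : M} :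
    x ∈ pullbackOpens e B ↔ x ∈ e.source ∧ e x ∈ B :=
  Iff.rfl

/-- `pullbackOpens e B` lies in the source of `e`. [folklore] -/
theorem pullbackOpens_subset_source (e : OpenPartialHomeomorph M N) (B : Opens N) :
    (pullbackOpens e B : Set M) ⊆ e.source :=
  inter_subset_left

/-- **An open partial homeomorphism which is `C^∞` on its source, with `C^∞` inverse on its
target, restricts to a diffeomorphism `e ⁻¹' B ≅ B`** for every open `B` inside its target, both
sides carrying the open-submanifold structures (`TopologicalSpace.Opens.instChartedSpace`).
[folklore] -/
def opensDiffeomorphOfSubsetTarget (e : OpenPartialHomeomorph M N)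
    (he : ContMDiffOn I I' ∞ e e.source) (he' : ContMDiffOn I' I ∞ e.symm e.target)
    (B : Opens N) (hB : (B : Set N) ⊆ e.target) :
    (pullbackOpens e B) ≃ₘ⟮I, I'⟯ B where
  toFun x := ⟨e x.1, x.2.2⟩
  invFun y := ⟨e.symm y.1, e.map_target (hB y.2), by
    show e (e.symm y.1) ∈ (B : Set N)
    rw [e.right_inv (hB y.2)]
    exact y.2⟩
  left_inv x := Subtype.ext (e.left_inv x.2.1)
  right_inv y := Subtype.ext (e.right_inv (hB y.2))
  contMDiff_toFun := by
    refine (ContMDiff.subtypeVal_comp_iff B _).mp ?_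
    intro x
    show ContMDiffAt I I' ∞ (fun x : pullbackOpens e B => e (x : M)) x
    exact contMDiffAt_subtype_iff.mpr (he.contMDiffAt (e.open_source.mem_nhds x.2.1))
  contMDiff_invFun := by
    refine (ContMDiff.subtypeVal_comp_iff (pullbackOpens e B) _).mp ?_
    intro y
    show ContMDiffAt I' I ∞ (fun y : B => e.symm (y : N)) y
    exact contMDiffAt_subtype_iff.mpr (he'.contMDiffAt (e.open_target.mem_nhds (hB y.2)))

/-- The restricted diffeomorphism is `e` on points. [folklore] -/
@[simp]
theorem coe_opensDiffeomorphOfSubsetTarget_apply (e : OpenPartialHomeomorph M N)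
    (he : ContMDiffOn I I' ∞ e e.source) (he' : ContMDiffOn I' I ∞ e.symm e.target)
    (B : Opens N) (hB : (B : Set N) ⊆ e.target) (x : pullbackOpens e B) :
    (opensDiffeomorphOfSubsetTarget I I' e he he' B hB x : N) = e x :=
  rfl

/-- Two equal open subsets are diffeomorphic: the two inclusions `V ↪ W`, `W ↪ V`
(`TopologicalSpace.Opens.inclusion`, smooth by `contMDiff_inclusion`), as DATA and for any model
`I`; the `Prop`-level special case for `Opens ℝ⁴` is `nonempty_diffeomorph_of_eq` of
`ExoticOpenFourSpaceProofs.lean` (`= ⟨diffeomorphOfEq (𝓡 4) h⟩`). [folklore] -/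
def diffeomorphOfEq {V W : Opens M} (h : V = W) : V ≃ₘ⟮I, I⟯ W where
  toFun := Opens.inclusion h.le
  invFun := Opens.inclusion h.ge
  left_inv _ := rfl
  right_inv _ := rfl
  contMDiff_toFun := contMDiff_inclusion h.le
  contMDiff_invFun := contMDiff_inclusion h.ge

variable [IsManifold I ∞ M]

/-- **A chart of a `C^∞` manifold restricts to a diffeomorphism `χₓ⁻¹(B) ≅ B`** for every open
`B` inside its target (charts of the maximal `C^∞` atlas are smooth with smooth inverse:
`contMDiffOn_chart`, `contMDiffOn_chart_symm`). Generalises `spherePullbackDiffeomorph` of the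
barrier file from the stereographic charts of `S⁴` to any chart. [folklore] -/
def chartPullbackDiffeomorph (x : M) (B : Opens H) (hB : (B : Set H) ⊆ (chartAt H x).target) :
    (pullbackOpens (chartAt H x) B) ≃ₘ⟮I, I⟯ B :=
  opensDiffeomorphOfSubsetTarget I I (chartAt H x) contMDiffOn_chart contMDiffOn_chart_symm B hB

end Plumbing

/-! ### Pushing an open subset of an inner product space into a round ball -/

section Ball

variable {F : Type*} [NormedAddCommGroup F] [InnerProductSpace ℝ F]

/-- The push-forward `univBall c r '' U` of an open `U ⊆ F` into the ball `ball c r`, written as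
the pull-back of `U` along `(univBall c r).symm`. [folklore] -/
def ballPushforward (c : F) (r : ℝ) (U : Opens F) : Opens F :=
  pullbackOpens (OpenPartialHomeomorph.univBall c r).symm U

/-- For `r > 0` the push-forward lies in the open ball `ball c r`. [folklore] -/
theorem ballPushforward_subset_ball (c : F) {r : ℝ} (hr : 0 < r) (U : Opens F) :
    (ballPushforward c r U : Set F) ⊆ Metric.ball c r := by
  intro y hy
  have h := pullbackOpens_subset_source (OpenPartialHomeomorph.univBall c r).symm U hy
  rwa [OpenPartialHomeomorph.symm_source, OpenPartialHomeomorph.univBall_target c hr] at h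

/-- **`univBall c r '' U ≅ U` as open submanifolds of `F`** (`r > 0`): Mathlib's
`OpenPartialHomeomorph.univBall c r` is a `C^∞` diffeomorphism of `F` onto `ball c r`
(`contDiff_univBall`, `contDiffOn_univBall_symm`). [folklore] -/
def ballPushforwardDiffeomorph (c : F) {r : ℝ} (hr : 0 < r) (U : Opens F) :
    (ballPushforward c r U) ≃ₘ⟮𝓘(ℝ, F), 𝓘(ℝ, F)⟯ U :=
  opensDiffeomorphOfSubsetTarget 𝓘(ℝ, F) 𝓘(ℝ, F) (OpenPartialHomeomorph.univBall c r).symm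
    (by
      rw [OpenPartialHomeomorph.symm_source, OpenPartialHomeomorph.univBall_target c hr]
      exact contMDiffOn_iff_contDiffOn.mpr OpenPartialHomeomorph.contDiffOn_univBall_symm)
    (by
      rw [OpenPartialHomeomorph.symm_symm, OpenPartialHomeomorph.symm_target]
      exact contMDiffOn_iff_contDiffOn.mpr OpenPartialHomeomorph.contDiff_univBall.contDiffOn)
    U
    (by
      rw [OpenPartialHomeomorph.symm_target, OpenPartialHomeomorph.univBall_source]
      exact subset_univ _)

end Ball

/-! ### Every smooth 4-manifold contains a small exotic `ℝ⁴` (relative to spc4.S11) -/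

/-- **Transport of an open subset of `ℝ⁴` into any smooth 4-manifold, up to diffeomorphism.**
For every nonempty `C^∞` manifold `M` modelled on `ℝ⁴` there is a map `Φ : Opens ℝ⁴ → Opens M`
with `Φ U ≅ U` for all `U`: push `U` into a round ball inside a chart target (`univBall`) and pull
back along the chart. [folklore] -/
theorem exists_opens_map_diffeomorph (M : Type*) [TopologicalSpace M] [ChartedSpace (𝔼 4) M]
    [IsManifold (𝓡 4) ∞ M] [Nonempty M] :
    ∃ Φ : Opens (𝔼 4) → Opens M, ∀ U, Nonempty ((Φ U) ≃ₘ⟮𝓡 4, 𝓡 4⟯ U) := by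
  obtain ⟨x⟩ := ‹Nonempty M›
  obtain ⟨r, hr, hball⟩ := Metric.isOpen_iff.mp (chartAt (𝔼 4) x).open_target
    (chartAt (𝔼 4) x x) (mem_chart_target _ x)
  refine ⟨fun U => pullbackOpens (chartAt (𝔼 4) x) (ballPushforward (chartAt (𝔼 4) x x) r U),
    fun U => ⟨?_⟩⟩
  exact (chartPullbackDiffeomorph (𝓡 4) x _
    ((ballPushforward_subset_ball _ hr U).trans hball)).trans
      (ballPushforwardDiffeomorph (chartAt (𝔼 4) x x) hr U)

/-- **Every nonempty smooth 4-manifold contains an open subset homeomorphic but not diffeomorphic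
to `ℝ⁴`**, relative to the tree's small exotic `ℝ⁴` (spc4.S11, hypothesis `hR`): the exotic open
`U ⊆ ℝ⁴` of Kirby's Theorem XIV.3 ("There exists an exotic `R⁴_Θ` which imbeds smoothly in
`S⁴`", hence in every coordinate chart) transported into `M` by `exists_opens_map_diffeomorph`.
Generalises `exists_opens_sphere_homeomorph_not_diffeomorph` (`M = S⁴`, with `Nonempty (𝕊 4)`
supplied by hand) of the barrier file. [cite: Kirby1989, Ch. XIV Thm. 3] -/
theorem exists_opens_homeomorph_not_diffeomorph_of_exoticR4
    (hR : Literature.Topology.FourManifolds.exists_opens_nonempty_homeomorph_isEmpty_diffeomorph_euclideanSpace_four)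
    (M : Type*) [TopologicalSpace M] [ChartedSpace (𝔼 4) M] [IsManifold (𝓡 4) ∞ M] [Nonempty M] :
    ∃ V : Opens M, Nonempty (V ≃ₜ 𝔼 4) ∧ IsEmpty (V ≃ₘ⟮𝓡 4, 𝓡 4⟯ 𝔼 4) := by
  obtain ⟨U, ⟨e⟩, hE⟩ := hR
  obtain ⟨Φ, hΦ⟩ := exists_opens_map_diffeomorph M
  obtain ⟨d⟩ := hΦ U
  exact ⟨Φ U, ⟨d.toHomeomorph.trans e⟩, ⟨fun d' => hE.false (d.symm.trans d')⟩⟩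

/-- **The master statement fails inside every smooth 4-manifold** (relative to spc4.S11): for no
nonempty `C^∞` 4-manifold `M` is every open subset of `M` homeomorphic to `ℝ⁴` diffeomorphic to
`ℝ⁴`. At `M = ℝ⁴` this is literally `openAnalogueBarrierFour_of_exoticR4`; at Mathlib's `S⁴`
(`Metric.sphere 0 1 ⊂ ℝ⁵`, where `Nonempty` is not an instance and has to be supplied by hand) it
is `not_forall_opens_sphere_diffeomorph` of the barrier file; for a homotopy 4-sphere `Σ` it says
that exotic open `ℝ⁴`-homeomorphs inside `Σ` never distinguish `Σ` from `S⁴`.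
[cite: Kirby1989, Ch. XIV p. 95 and Thm. 3] -/
theorem not_forall_opens_diffeomorph_of_exoticR4
    (hR : Literature.Topology.FourManifolds.exists_opens_nonempty_homeomorph_isEmpty_diffeomorph_euclideanSpace_four)
    (M : Type*) [TopologicalSpace M] [ChartedSpace (𝔼 4) M] [IsManifold (𝓡 4) ∞ M] [Nonempty M] :
    ¬ ∀ V : Opens M, Nonempty (V ≃ₜ 𝔼 4) → Nonempty (V ≃ₘ⟮𝓡 4, 𝓡 4⟯ 𝔼 4) := by
  intro h
  obtain ⟨V, hV, hE⟩ := exists_opens_homeomorph_not_diffeomorph_of_exoticR4 hR M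
  obtain ⟨d⟩ := h V hV
  exact hE.false d

/-- **The barrier, transported**: `OpenAnalogueBarrierFour` (`¬ OpenSubsetUniquenessFour`, the
failure inside standard `ℝ⁴`) already implies the failure inside every nonempty smooth
4-manifold, via `openAnalogueBarrierFour_iff_exoticR4`. [cite: Kirby1989, Ch. XIV Thm. 3] -/
theorem OpenAnalogueBarrierFour.not_forall_opens_diffeomorph (h : OpenAnalogueBarrierFour)
    (M : Type*) [TopologicalSpace M] [ChartedSpace (𝔼 4) M] [IsManifold (𝓡 4) ∞ M] [Nonempty M] :
    ¬ ∀ V : Opens M, Nonempty (V ≃ₜ 𝔼 4) → Nonempty (V ≃ₘ⟮𝓡 4, 𝓡 4⟯ 𝔼 4) :=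
  not_forall_opens_diffeomorph_of_exoticR4 (openAnalogueBarrierFour_iff_exoticR4.mp h) M

/-! ### Continuum many, in every smooth 4-manifold (relative to DeMichelis–Freedman) -/

/-- **DeMichelis–Freedman, transported**: relative to `deMichelisFreedman1992_continuum`
(continuum many pairwise non-diffeomorphic open `ℝ⁴`-homeomorphs in standard `ℝ⁴`, Thm. 4.1 with
Cor. 4.1), every nonempty smooth 4-manifold `M` contains a family of open subsets of the
cardinality of the continuum, each homeomorphic to `ℝ⁴`, no two distinct members of which are
diffeomorphic. [cite: DeMichelisFreedman1992, Thm. 4.1 and Cor. 4.1] -/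
theorem exists_continuum_opens_of_deMichelisFreedman (h : deMichelisFreedman1992_continuum)
    (M : Type*) [TopologicalSpace M] [ChartedSpace (𝔼 4) M] [IsManifold (𝓡 4) ∞ M] [Nonempty M] :
    ∃ R : Set (Opens M), Cardinal.mk R = Cardinal.continuum ∧
      (∀ V ∈ R, Nonempty (V ≃ₜ 𝔼 4)) ∧
      ∀ V ∈ R, ∀ W ∈ R, Nonempty (V ≃ₘ⟮𝓡 4, 𝓡 4⟯ W) → V = W := by
  obtain ⟨R₀, hcard, htop, hdiff⟩ := h
  obtain ⟨Φ, hΦ⟩ := exists_opens_map_diffeomorph M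
  have d : ∀ U : Opens (𝔼 4), (Φ U) ≃ₘ⟮𝓡 4, 𝓡 4⟯ U := fun U => (hΦ U).some
  -- distinct members of `R₀` stay non-diffeomorphic, hence distinct, after transport
  have hsep : ∀ U ∈ R₀, ∀ U' ∈ R₀, Nonempty ((Φ U) ≃ₘ⟮𝓡 4, 𝓡 4⟯ (Φ U')) → U = U' := by
    rintro U hU U' hU' ⟨g⟩
    exact hdiff U hU U' hU' ⟨(d U).symm.trans (g.trans (d U'))⟩
  have hinj : InjOn Φ R₀ := fun U hU U' hU' hUU' =>
    hsep U hU U' hU' ⟨diffeomorphOfEq (𝓡 4) hUU'⟩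
  refine ⟨Φ '' R₀, ?_, ?_, ?_⟩
  · have h1 := Cardinal.mk_image_eq_of_injOn_lift Φ R₀ hinj
    rwa [Cardinal.lift_uzero, hcard, Cardinal.lift_continuum] at h1
  · rintro _ ⟨U, hU, rfl⟩
    obtain ⟨e⟩ := htop U hU
    exact ⟨(d U).toHomeomorph.trans e⟩
  · rintro _ ⟨U, hU, rfl⟩ _ ⟨U', hU', rfl⟩ hVW
    rw [hsep U hU U' hU' hVW]

end Literature.Barriers.SmoothPoincare4

end
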